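import Summits.HubbardSuperconductivity.HubbardSuperconductivity.Theorems.AnisotropyChordTransferFibre3FinXB2Cert

/-!
# Route `AnisotropyChord` / H0 rotor rung: FIN mid-`L` evaluator XB2 — the λ-cell cover and the row-`N₁` crux per `L`

The per-`L` packaging of the XB2 cell certificate `…Fibre3FinXB2Cert.xb2_cell_sound` (XB2 analogue of `…FinXBCover`, same
cover arithmetic `cover_allQ`, same vacuity branches): ★ `xb2_cellAny_sound`, ★ `xb2_of_check` (every ground profile at
`0 < Δ ≤ Δ₁ < 1` has `c·U ≤ N₁` with the constant of its cell), ★★ `trialGapAbs_of_check2` (`TrialGapAbs L Δ c` for any `c` below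
every cell constant) and ★★ `trialGapAbs_cell_of_check2` (the per-cell constant).  A kernel fact `xbCheck2 L Δ₁ cells = true` is
assembled from cell facts `xbCellAny2 L Δ₁ la lb c = true` (each decided directly, or via certified literal point wedges
`tWedgePt L la = …`, `tWedgePt L lb = …` and `xbCellAnyT`).
Prover seat `hubbard-h0-rotor-p3` g6; helper for piece A = stmt-HubbardSuperconductivity-23918 of rung 19089 (`--supports`, helper
class).  WHAT THIS IS NOT: nothing here proves superconductivity in the Hubbard model (rotor TARGET as worded stays FALSE, g15 verdict);
the FIN form of ONE hypothesis (the `N₁` row) of ONE conditional reduction.  Tree imports only; no sorry, no new axioms.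
-/

set_option linter.dupNamespace false
set_option autoImplicit false

namespace Summit.HubbardSuperconductivity.HubbardSuperconductivity.Theorems.AnisotropyChord.Transfer.Fibre3

namespace FinXB

open scoped BigOperators
open Finset Hole2 FinCell

/-- one cell: for a ground profile at `0 < Δ ≤ Δ₁ < 1` with `λ₂·D` in a cell passing `xbCellAny2`, `c·U ≤ N₁`. [folklore] -/
theorem xb2_cellAny_sound (L : ℕ) [NeZero L] (hL : 5 ≤ L) {d1 : ℚ} {Δ lam2 : ℝ} (hΔ0 : 0 < Δ) (hΔd : Δ ≤ (d1 : ℝ))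
    (hΔ1 : Δ < 1) {f : Tor L → ℝ} (hf : IsGroundTwoMagnon L Δ lam2 f) {la lb : ℤ}
    (hla : (la : ℝ) ≤ lam2 * ((D : ℤ) : ℝ)) (hlb : lam2 * ((D : ℤ) : ℝ) ≤ (lb : ℝ)) {c : ℚ}
    (hok : xbCellAny2 L d1 la lb c = true) : (c : ℝ) * Uunit L Δ f ≤ trialGapN1 L Δ f := by
  have hL3 : 3 ≤ L := by omega
  have hD := D_pos
  have hlam : 0 < lam2 := lam2_pos L hL3 hΔ1 hf.1
  have hΔe : Δ = deltaOfLam L lam2 := ground_delta_eq L hL hΔ0.le hΔ1 hf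
  unfold xbCellAny2 xbCellAnyT at hok
  simp only [Bool.or_eq_true, Bool.and_eq_true, decide_eq_true_eq] at hok
  rcases hok with (⟨⟨hpos, hnum⟩, hG0⟩ | ⟨hgc, hvac⟩) | hcert
  · exact (vacuous_of_num_neg (L := L) hL3 hlam hla hlb hpos hnum hG0 hΔ0 hΔ1 hΔe).elim
  · exfalso
    have hmd := mem_delta_cell L hL3 hlam hla hlb hgc
    rw [← hΔe] at hmd
    obtain ⟨hlo, hhi⟩ := hmd
    rcases hvac with hneg | hbig
    · have : ((((deltaIv L la lb).2 : ℤ)) : ℝ) < 0 := by exact_mod_cast hneg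
      nlinarith
    · have hbig' : (d1 : ℝ) * ((D : ℤ) : ℝ) < ((((deltaIv L la lb).1 : ℤ)) : ℝ) := by
        have := hbig
        have e : (((D : ℚ)) : ℝ) = ((D : ℤ) : ℝ) := by norm_cast
        rw [← e]; exact_mod_cast this
      nlinarith
  · exact xb2_cell_sound hL hΔ0.le hΔ1 hf hla hlb hcert

/-- ★ from the per-`L` XB2 certificate: every ground profile at `0 < Δ ≤ Δ₁`, `Δ < 1` satisfies `c·U ≤ N₁` with the constant
of its cell (some entry of the list). [folklore] -/
theorem xb2_of_check (L : ℕ) [NeZero L] (hL : 7 ≤ L) {d1 : ℚ} {cells : List (ℤ × ℚ)} (h : xbCheck2 L d1 cells = true)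
    {Δ : ℝ} (hΔ0 : 0 < Δ) (hΔd : Δ ≤ (d1 : ℝ)) (hΔ1 : Δ < 1) :
    ∀ lam2 : ℝ, ∀ f : Tor L → ℝ, IsGroundTwoMagnon L Δ lam2 f →
      ∃ q ∈ cells.map Prod.snd, (q : ℝ) * Uunit L Δ f ≤ trialGapN1 L Δ f := by
  refine forall_ground_of_window_7 L hL hΔ0.le hΔ1 _ ?_
  intro lam2 f hf hlam0 hlamle
  have hD := D_pos
  unfold xbCheck2 at h
  simp only [Bool.and_eq_true, decide_eq_true_eq] at h
  obtain ⟨⟨⟨hhead, hlen⟩, htop⟩, hok⟩ := h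
  obtain ⟨a, b, rest, hcells⟩ : ∃ a b : ℤ × ℚ, ∃ rest : List (ℤ × ℚ), cells = a :: b :: rest := by
    match cells, hlen with
    | a :: b :: rest, _ => exact ⟨a, b, rest, rfl⟩
  subst hcells
  have ha0 : a.1 = 0 := by simpa using hhead
  set x : ℝ := lam2 * ((D : ℤ) : ℝ) with hx
  have hx0 : (a.1 : ℝ) ≤ x := by rw [ha0, hx]; push_cast; positivity
  have hxtop : x ≤ ((cellsLastQ (a :: b :: rest) : ℤ) : ℝ) :=
    (lam_mul_D_le_lamTop L (by omega) hlamle).trans (by exact_mod_cast htop)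
  obtain ⟨c, d, q, hcell, hcx, hxd, hq⟩ := cover_allQ (xbCellAny2 L d1) rest a b x hok hx0 hxtop
  exact ⟨q, hq, xb2_cellAny_sound L (by omega) hΔ0 hΔd hΔ1 hf hcx hxd hcell⟩

/-- ★★ THE ROW-`N₁` CRUX AT THIS `L` (XB2) with a uniform constant: `TrialGapAbs L Δ c` for `0 < Δ ≤ Δ₁`, `Δ < 1` and any `c`
below every cell constant. [folklore] -/
theorem trialGapAbs_of_check2 (L : ℕ) [NeZero L] (hL : 7 ≤ L) {d1 : ℚ} {cells : List (ℤ × ℚ)}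
    (h : xbCheck2 L d1 cells = true) {c : ℚ} (hc : ∀ q ∈ cells.map Prod.snd, c ≤ q)
    {Δ : ℝ} (hΔ0 : 0 < Δ) (hΔd : Δ ≤ (d1 : ℝ)) (hΔ1 : Δ < 1) :
    TrialGapAbs L Δ c := by
  intro lam2 f hf
  obtain ⟨q, hq, hle⟩ := xb2_of_check L hL h hΔ0 hΔd hΔ1 lam2 f hf
  have hU : 0 < Uunit L Δ f := by
    unfold Uunit
    have hT := Tplus_pos L (by omega) hΔ1 hf
    have hLpos : (0 : ℝ) < L := by exact_mod_cast (show 0 < L by omega)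
    positivity
  have hcq : ((c : ℚ) : ℝ) ≤ ((q : ℚ) : ℝ) := by exact_mod_cast hc q hq
  exact (mul_le_mul_of_nonneg_right hcq hU.le).trans hle

/-- ★★ the per-cell form: at `0 < Δ ≤ Δ₁`, `Δ < 1`, there is a cell constant `q` (that of the cell of the ground `λ₂(Δ)`) with
`TrialGapAbs L Δ q`. [folklore] -/
theorem trialGapAbs_cell_of_check2 (L : ℕ) [NeZero L] (hL : 7 ≤ L) {d1 : ℚ} {cells : List (ℤ × ℚ)}
    (h : xbCheck2 L d1 cells = true) {Δ : ℝ} (hΔ0 : 0 < Δ) (hΔd : Δ ≤ (d1 : ℝ)) (hΔ1 : Δ < 1) :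
    ∃ q ∈ cells.map Prod.snd, TrialGapAbs L Δ q := by
  obtain ⟨lam2, f, hf⟩ := exists_ground L (by omega) Δ
  obtain ⟨q, hq, hle⟩ := xb2_of_check L hL h hΔ0 hΔd hΔ1 lam2 f hf
  refine ⟨q, hq, fun lam2' f' hf' => ?_⟩
  have hl : lam2' = lam2 := ground_lam2_unique L (by omega) hf' hf
  subst hl
  have hff : f' = f := by
    rw [ground_eq_explicit L (by omega) hΔ0.le hΔ1 hf', ground_eq_explicit L (by omega) hΔ0.le hΔ1 hf]
  subst hff
  exact hle

end FinXB

end Summit.HubbardSuperconductivity.HubbardSuperconductivity.Theorems.AnisotropyChord.Transfer.Fibre3
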